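import Mathlib
import HarnessLib

/-!
# Moment-difference inequality (stub `stub_momentDiff`, line `Sketch`, crux `JoiningsTransfer`)

Pure measure theory on a probability space: if `Y i, Z i : Ω → ℝ` (`i : Fin n`) are bounded
measurable random variables with `E (Y i - Z i)² ≤ η` and `2(n-1)`-th moments `≤ M`, then
`|E ∏ Y i - E ∏ Z i| ≤ n √η √M`.

Proof: the telescoping identity `∏ Y - ∏ Z = ∑ i (Y i - Z i) ∏_{j ≠ i} W i j` with
`W i j = Z j` for `j < i` and `W i j = Y j` for `i < j`, Cauchy–Schwarz for each term, and the
AM–GM inequality `∏_{j ≠ i} W² ≤ (n-1)⁻¹ ∑_{j ≠ i} W^{2(n-1)}` to bound `E ∏_{j≠i} (W i j)²` by `M`.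

This file serves stub `stub_momentDiff` of line `Sketch` of crux stmt-CriticalPhenomena-18764
(`Summit.CriticalPhenomena.Ising3DConformalLimit.Theses.SynchronousCoupling.JoiningsTransfer`).
Sources: folklore (Cauchy–Schwarz, weighted AM–GM from Mathlib); no published fact is used.
-/

noncomputable section

namespace Summit.CriticalPhenomena.Ising3DConformalLimit.Cruxes.JoiningsTransfer.Sketch

open MeasureTheory Filter Set
open scoped BigOperators

/-- Telescoping identity for a difference of two products over `Fin n`, written with a full
product carrying a unit factor at the pivot index. [folklore] -/
private theorem stub_momentDiff_telescope_ite {R : Type*} [CommRing R] :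
    ∀ (n : ℕ) (a b : Fin n → R), ∏ i, a i - ∏ i, b i =
      ∑ i, (a i - b i) * ∏ j, (if j = i then 1 else if j < i then b j else a j) := by
  intro n
  induction n with
  | zero => intro a b; simp
  | succ n ih =>
    intro a b
    have h0 : ∀ i : Fin n, (0 : Fin (n + 1)) ≠ i.succ := fun i => (Fin.succ_ne_zero i).symm
    simp only [Fin.prod_univ_succ, Fin.sum_univ_succ, Fin.succ_inj, Fin.succ_lt_succ_iff,
      Fin.succ_ne_zero, h0, Fin.not_lt_zero, Fin.succ_pos, if_true, if_false, one_mul,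
      mul_left_comm _ (b 0), ← Finset.mul_sum]
    linear_combination (b 0) * ih (fun i => a i.succ) (fun i => b i.succ)

/-- Telescoping identity for a difference of two products over `Fin n`, `Finset.erase` form:
`∏ a - ∏ b = ∑ i (a i - b i) ∏_{j ≠ i} c i j` with `c i j = b j` for `j < i` and `a j` for
`i < j`. [folklore] -/
private theorem stub_momentDiff_telescope {R : Type*} [CommRing R] {n : ℕ} (a b : Fin n → R) :
    ∏ i, a i - ∏ i, b i =
      ∑ i, (a i - b i) * ∏ j ∈ Finset.univ.erase i, (if j < i then b j else a j) := by
  rw [stub_momentDiff_telescope_ite n a b]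
  refine Finset.sum_congr rfl fun i _ => ?_
  congr 1
  rw [← Finset.prod_erase (s := Finset.univ) (a := i)
    (f := fun j => if j = i then (1 : R) else if j < i then b j else a j) (by simp)]
  exact Finset.prod_congr rfl fun j hj => if_neg (Finset.ne_of_mem_erase hj)

/-- Cauchy–Schwarz for real integrals, `|∫ f g| ≤ √(∫ f²) √(∫ g²)`, obtained from the sign of
the discriminant of `t ↦ ∫ (t f - g)²`. [folklore] -/
private theorem stub_momentDiff_cauchySchwarz {Ω : Type*} [MeasurableSpace Ω] (P : Measure Ω)
    (f g : Ω → ℝ) (hf : Integrable (fun ω => f ω ^ 2) P) (hg : Integrable (fun ω => g ω ^ 2) P)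
    (hfg : Integrable (fun ω => f ω * g ω) P) :
    |∫ ω, f ω * g ω ∂P| ≤ Real.sqrt (∫ ω, f ω ^ 2 ∂P) * Real.sqrt (∫ ω, g ω ^ 2 ∂P) := by
  have hA0 : 0 ≤ ∫ ω, f ω ^ 2 ∂P := integral_nonneg fun ω => sq_nonneg _
  have hquad : ∀ t : ℝ, 0 ≤ (∫ ω, f ω ^ 2 ∂P) * (t * t) + (-(2 * ∫ ω, f ω * g ω ∂P)) * t
      + ∫ ω, g ω ^ 2 ∂P := by
    intro t
    have h1 : Integrable (fun ω => t * t * f ω ^ 2 - 2 * t * (f ω * g ω)) P :=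
      (hf.const_mul _).sub (hfg.const_mul _)
    have h2 : (fun ω => (t * f ω - g ω) ^ 2)
        = fun ω => t * t * f ω ^ 2 - 2 * t * (f ω * g ω) + g ω ^ 2 := by
      funext ω; ring
    have h3 : 0 ≤ ∫ ω, (t * f ω - g ω) ^ 2 ∂P := integral_nonneg fun ω => sq_nonneg _
    rw [h2, integral_add h1 hg, integral_sub (hf.const_mul _) (hfg.const_mul _),
      integral_const_mul, integral_const_mul] at h3
    linarith
  have hdisc := discrim_le_zero hquad
  rw [discrim] at hdisc
  rw [← Real.sqrt_mul hA0]
  refine Real.abs_le_sqrt ?_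
  nlinarith [hdisc]

/-- **Stub B** (`stub_momentDiff`): for bounded measurable `Y i, Z i` on a probability space with
`∫ (Y i - Z i)² ≤ η` and `2(n-1)`-th moments of all `Y i, Z i` bounded by `M`,
`|∫ ∏ Y i - ∫ ∏ Z i| ≤ n √η √M`. [folklore] -/
theorem stub_momentDiff : ∀ (Ω : Type) [MeasurableSpace Ω] (P : Measure Ω) [IsProbabilityMeasure P] (n : ℕ)
    (Y Z : Fin n → Ω → ℝ) (M η : ℝ),
    (∀ i, Measurable (Y i)) → (∀ i, Measurable (Z i)) →
    (∀ i, ∃ B : ℝ, ∀ ω, |Y i ω| ≤ B ∧ |Z i ω| ≤ B) →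
    (∀ i, ∫ ω, (Y i ω) ^ (2 * (n - 1)) ∂P ≤ M) → (∀ i, ∫ ω, (Z i ω) ^ (2 * (n - 1)) ∂P ≤ M) →
    (∀ i, ∫ ω, (Y i ω - Z i ω) ^ 2 ∂P ≤ η) →
    |(∫ ω, ∏ i, Y i ω ∂P) - ∫ ω, ∏ i, Z i ω ∂P| ≤ n * Real.sqrt η * Real.sqrt M := by
  intro Ω _ P _ n Y Z M η hYm hZm hB hYM hZM hη
  -- bounded measurable functions on a finite measure space are integrable
  have hInt : ∀ (f : Ω → ℝ) (C : ℝ), Measurable f → (∀ ω, |f ω| ≤ C) → Integrable f P :=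
    fun f C hf hC => Integrable.of_bound hf.aestronglyMeasurable C
      (ae_of_all _ fun ω => by rw [Real.norm_eq_abs]; exact hC ω)
  choose B hB using hB
  rcases n with _ | m
  · simp
  simp only [Nat.add_sub_cancel] at hYM hZM
  -- the mixed variables `W i j = Z j` (`j < i`), `= Y j` (otherwise)
  obtain ⟨W, hW⟩ : ∃ W : Fin (m + 1) → Fin (m + 1) → Ω → ℝ,
      ∀ i j ω, W i j ω = if j < i then Z j ω else Y j ω :=
    ⟨fun i j ω => if j < i then Z j ω else Y j ω, fun _ _ _ => rfl⟩
  have hWm : ∀ i j, Measurable (W i j) := by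
    intro i j
    by_cases h : j < i
    · have h' : W i j = Z j := funext fun ω => by rw [hW, if_pos h]
      rw [h']; exact hZm j
    · have h' : W i j = Y j := funext fun ω => by rw [hW, if_neg h]
      rw [h']; exact hYm j
  have hWb : ∀ i j ω, |W i j ω| ≤ B j := by
    intro i j ω; rw [hW]; split_ifs; exacts [(hB j ω).2, (hB j ω).1]
  have hWM : ∀ i j, ∫ ω, (W i j ω) ^ (2 * m) ∂P ≤ M := by
    intro i j
    by_cases h : j < i
    · simp only [hW, if_pos h]; exact hZM j
    · simp only [hW, if_neg h]; exact hYM j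
  -- the cofactor products `R i = ∏_{j ≠ i} W i j`
  obtain ⟨R, hR⟩ : ∃ R : Fin (m + 1) → Ω → ℝ,
      ∀ i ω, R i ω = ∏ j ∈ Finset.univ.erase i, W i j ω := ⟨_, fun _ _ => rfl⟩
  have hRm : ∀ i, Measurable (R i) := by
    intro i
    have h' : R i = fun ω => ∏ j ∈ Finset.univ.erase i, W i j ω := funext (hR i)
    rw [h']
    exact Finset.measurable_prod _ fun j _ => hWm i j
  have hRb : ∀ i ω, |R i ω| ≤ ∏ j ∈ Finset.univ.erase i, B j := by
    intro i ω
    rw [hR, Finset.abs_prod]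
    exact Finset.prod_le_prod (fun j _ => abs_nonneg _) fun j _ => hWb i j ω
  -- integrability of everything in sight
  have hYZb : ∀ i ω, |Y i ω - Z i ω| ≤ B i + B i := fun i ω =>
    (abs_sub _ _).trans (add_le_add (hB i ω).1 (hB i ω).2)
  have hD2 : ∀ i, Integrable (fun ω => (Y i ω - Z i ω) ^ 2) P := fun i =>
    hInt _ ((B i + B i) ^ 2) (((hYm i).sub (hZm i)).pow_const 2) fun ω => by
      rw [abs_pow]; exact pow_le_pow_left₀ (abs_nonneg _) (hYZb i ω) 2
  have hR2 : ∀ i, Integrable (fun ω => (R i ω) ^ 2) P := fun i =>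
    hInt _ ((∏ j ∈ Finset.univ.erase i, B j) ^ 2) ((hRm i).pow_const 2) fun ω => by
      rw [abs_pow]; exact pow_le_pow_left₀ (abs_nonneg _) (hRb i ω) 2
  have hDR : ∀ i, Integrable (fun ω => (Y i ω - Z i ω) * R i ω) P := fun i =>
    hInt _ ((B i + B i) * ∏ j ∈ Finset.univ.erase i, B j) (((hYm i).sub (hZm i)).mul (hRm i))
      fun ω => by
        rw [abs_mul]
        exact mul_le_mul (hYZb i ω) (hRb i ω) (abs_nonneg _) ((abs_nonneg _).trans (hYZb i ω))
  have hPY : Integrable (fun ω => ∏ i, Y i ω) P :=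
    hInt _ (∏ i, B i) (Finset.measurable_prod _ fun i _ => hYm i) fun ω => by
      rw [Finset.abs_prod]
      exact Finset.prod_le_prod (fun j _ => abs_nonneg _) fun j _ => (hB j ω).1
  have hPZ : Integrable (fun ω => ∏ i, Z i ω) P :=
    hInt _ (∏ i, B i) (Finset.measurable_prod _ fun i _ => hZm i) fun ω => by
      rw [Finset.abs_prod]
      exact Finset.prod_le_prod (fun j _ => abs_nonneg _) fun j _ => (hB j ω).2
  -- second moment of the cofactor product: `∫ (R i)² ≤ M` (AM–GM and the moment bounds)
  have hRM : ∀ i, ∫ ω, (R i ω) ^ 2 ∂P ≤ M := by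
    intro i
    have hs : (Finset.univ.erase i).card = m := by
      rw [Finset.card_erase_of_mem (Finset.mem_univ i), Finset.card_univ, Fintype.card_fin,
        Nat.add_sub_cancel]
    rcases Nat.eq_zero_or_pos m with hm0 | hm0
    · -- no cofactor: `R i = 1`, and the moment hypothesis reads `∫ 1 ≤ M`
      subst hm0
      have hs0 : Finset.univ.erase i = ∅ := Finset.card_eq_zero.mp hs
      have h1 : ∀ ω, R i ω = 1 := fun ω => by rw [hR, hs0, Finset.prod_empty]
      have h2 := hYM i
      simp only [Nat.mul_zero, pow_zero] at h2
      simp only [h1, one_pow]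
      exact h2
    · have hmR : (m : ℝ) ≠ 0 := Nat.cast_ne_zero.mpr hm0.ne'
      have key : ∀ ω, (R i ω) ^ 2
          ≤ (m : ℝ)⁻¹ * ∑ j ∈ Finset.univ.erase i, (W i j ω) ^ (2 * m) := by
        intro ω
        have hamgm := Real.geom_mean_le_arith_mean_weighted (Finset.univ.erase i)
          (fun _ => (m : ℝ)⁻¹) (fun j => ((W i j ω) ^ 2) ^ m) (fun _ _ => by positivity)
          (by rw [Finset.sum_const, hs, nsmul_eq_mul, mul_inv_cancel₀ hmR])
          (fun _ _ => by positivity)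
        rw [hR, ← Finset.prod_pow]
        calc ∏ j ∈ Finset.univ.erase i, (W i j ω) ^ 2
            = ∏ j ∈ Finset.univ.erase i, (((W i j ω) ^ 2) ^ m) ^ (m : ℝ)⁻¹ :=
              Finset.prod_congr rfl fun j _ =>
                (Real.pow_rpow_inv_natCast (sq_nonneg _) hm0.ne').symm
          _ ≤ ∑ j ∈ Finset.univ.erase i, (m : ℝ)⁻¹ * ((W i j ω) ^ 2) ^ m := hamgm
          _ = (m : ℝ)⁻¹ * ∑ j ∈ Finset.univ.erase i, (W i j ω) ^ (2 * m) := by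
              rw [Finset.mul_sum]
              exact Finset.sum_congr rfl fun j _ => by rw [pow_mul]
      have hWi : ∀ j, Integrable (fun ω => (W i j ω) ^ (2 * m)) P := fun j =>
        hInt _ ((B j) ^ (2 * m)) ((hWm i j).pow_const _) fun ω => by
          rw [abs_pow]; exact pow_le_pow_left₀ (abs_nonneg _) (hWb i j ω) _
      have hSi : Integrable
          (fun ω => (m : ℝ)⁻¹ * ∑ j ∈ Finset.univ.erase i, (W i j ω) ^ (2 * m)) P :=
        (integrable_finsetSum _ fun j _ => hWi j).const_mul _
      calc ∫ ω, (R i ω) ^ 2 ∂P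
          ≤ ∫ ω, (m : ℝ)⁻¹ * ∑ j ∈ Finset.univ.erase i, (W i j ω) ^ (2 * m) ∂P :=
            integral_mono (hR2 i) hSi key
        _ = (m : ℝ)⁻¹ * ∑ j ∈ Finset.univ.erase i, ∫ ω, (W i j ω) ^ (2 * m) ∂P := by
            rw [integral_const_mul, integral_finsetSum _ fun j _ => hWi j]
        _ ≤ (m : ℝ)⁻¹ * ∑ j ∈ Finset.univ.erase i, M := by
            gcongr with j _
            exact hWM i j
        _ = M := by
            rw [Finset.sum_const, hs, nsmul_eq_mul, ← mul_assoc, inv_mul_cancel₀ hmR, one_mul]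
  -- per-term bound by Cauchy–Schwarz
  have hper : ∀ i, |∫ ω, (Y i ω - Z i ω) * R i ω ∂P| ≤ Real.sqrt η * Real.sqrt M := by
    intro i
    calc |∫ ω, (Y i ω - Z i ω) * R i ω ∂P|
        ≤ Real.sqrt (∫ ω, (Y i ω - Z i ω) ^ 2 ∂P) * Real.sqrt (∫ ω, (R i ω) ^ 2 ∂P) :=
          stub_momentDiff_cauchySchwarz P (fun ω => Y i ω - Z i ω) (R i) (hD2 i) (hR2 i) (hDR i)
      _ ≤ Real.sqrt η * Real.sqrt M :=
          mul_le_mul (Real.sqrt_le_sqrt (hη i)) (Real.sqrt_le_sqrt (hRM i)) (Real.sqrt_nonneg _)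
            (Real.sqrt_nonneg _)
  -- telescoping, pointwise
  have htel : ∀ ω, ∏ i, Y i ω - ∏ i, Z i ω = ∑ i, (Y i ω - Z i ω) * R i ω := by
    intro ω
    simp only [hR, hW]
    exact stub_momentDiff_telescope (fun i => Y i ω) (fun i => Z i ω)
  calc |(∫ ω, ∏ i, Y i ω ∂P) - ∫ ω, ∏ i, Z i ω ∂P|
      = |∫ ω, (∏ i, Y i ω - ∏ i, Z i ω) ∂P| := by rw [integral_sub hPY hPZ]
    _ = |∫ ω, ∑ i, (Y i ω - Z i ω) * R i ω ∂P| := by simp only [htel]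
    _ = |∑ i, ∫ ω, (Y i ω - Z i ω) * R i ω ∂P| := by
        rw [integral_finsetSum _ fun i _ => hDR i]
    _ ≤ ∑ i, |∫ ω, (Y i ω - Z i ω) * R i ω ∂P| := Finset.abs_sum_le_sum_abs _ _
    _ ≤ ∑ _i : Fin (m + 1), Real.sqrt η * Real.sqrt M := Finset.sum_le_sum fun i _ => hper i
    _ = ((m + 1 : ℕ) : ℝ) * Real.sqrt η * Real.sqrt M := by
        rw [Finset.sum_const, Finset.card_univ, Fintype.card_fin, nsmul_eq_mul, mul_assoc]

end Summit.CriticalPhenomena.Ising3DConformalLimit.Cruxes.JoiningsTransfer.Sketch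

end
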